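import Summits.AtomisticToContinuum.Crystallization.Theorems.FluxTubeKeplerFloorGivesLayered
import Summits.AtomisticToContinuum.Crystallization.Theorems.FluxTubeKeplerFluxCellKeplerSingleScale

/-!
# F3 witness for the forward rung `EnergyBlindRung` (energy-filter ladder over `FluxTubeKepler.FloorGivesLayered`)

`ERung ⊥` — FLOOR + the defect budget with NO energetic exemption (threshold `⊥`: every
`(R, η)`-bad site is priced, verbatim the budget hypothesis of `FloorGivesLayered`) force periodic
windows — is the proved floor: the seed `FluxTubeKeplerFloorGivesLayered.FloorGivesLayered_proof`
(stmt-AtomisticToContinuum-15223) followed by the proved `FluxTubeKepler.PeriodicGivenLayered_holds`.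
Self-contained copy (sub-namespace `Special`) of the five definitions of `Lines/EnergyBlindRung.lean`, so
that this file elaborates on its own; the canonical declarations `EnergyLadder.ERung`,
`EnergyLadder.eRung_bot` live there with the same text.  No `sorry`.
-/

noncomputable section

namespace Summit.AtomisticToContinuum.Crystallization.Cruxes.FluxCellKepler.EnergyLadder.Special

open Filter Topology
open Literature.MathematicalPhysics.StatisticalMechanics
open Summit.AtomisticToContinuum.Crystallization.Theorems.FluxCellKeplerSingleScale (LayeredGood)

local notation "E3" => EuclideanSpace ℝ (Fin 3)

/-- FLOOR(P₀): `N·e(P₀) ≤ E(x)` for every Lennard-Jones ground state `x` (verbatim the first hypothesis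
of `FluxTubeKepler.FloorGivesLayered`). -/
def Floor (P₀ : PeriodicConfiguration 3) : Prop :=
  ∀ (N : ℕ) (x : Fin N → E3), IsGroundState lennardJones x →
    (N : ℝ) * P₀.energyPerParticle lennardJones ≤ interactionEnergy lennardJones x

/-- ENERGY-FILTERED BUDGET(P₀) with threshold dial `θ`: at scale `(R, η)` only the `(R, η)`-bad sites
whose site-energy surplus `𝓔ⁱ(x) − 2 e(P₀)` is `≥ θ R η` (in `WithBot ℝ`) are priced. -/
def Budget (θ : ℝ → ℝ → WithBot ℝ) (P₀ : PeriodicConfiguration 3) : Prop :=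
  ∀ R η : ℝ, 0 < R → 0 < η → ∃ c : ℝ, 0 < c ∧
    ∀ (N : ℕ) (x : Fin N → E3), IsGroundState lennardJones x →
      c * (Nat.card {i : Fin N // ¬ LayeredGood R η x i ∧
            θ R η ≤ ((siteEnergy lennardJones x i - 2 * P₀.energyPerParticle lennardJones : ℝ) :
              WithBot ℝ)} : ℝ) ≤
        interactionEnergy lennardJones x - (N : ℝ) * P₀.energyPerParticle lennardJones

/-- Periodic windows along `x` (verbatim the conclusion of `ChessboardParticlePlanes.PeriodicWindows`). -/
def HasPeriodicWindows (x : (N : ℕ) → (Fin N → E3)) : Prop :=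
  ∃ P : PeriodicConfiguration 3, ∀ R ε : ℝ, 0 < ε → ∃ᶠ N in atTop, ∃ t : E3,
    (∀ s ∈ P.points, ‖s‖ ≤ R → ∃ i : Fin N, dist (x N i + t) s ≤ ε) ∧
    (∀ i : Fin N, ‖x N i + t‖ ≤ R → ∃ s ∈ P.points, dist (x N i + t) s ≤ ε)

/-- The graded family: FLOOR + the `θ`-filtered budget force periodic windows along ground states. -/
def ERung (θ : ℝ → ℝ → WithBot ℝ) : Prop :=
  ∀ P₀ : PeriodicConfiguration 3, Floor P₀ → Budget θ P₀ →
    ∀ x : (N : ℕ) → (Fin N → E3), (∀ N, IsGroundState lennardJones (x N)) → HasPeriodicWindows x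

/-- **The deciding rung.** SOME pointwise-positive real threshold: at every scale the bad sites whose
site-energy surplus is below `θ(R, η) > 0` go un-priced, and ground states still have periodic windows. -/
def EnergyBlindRung : Prop :=
  ∃ θ : ℝ → ℝ → ℝ, (∀ R η : ℝ, 0 < R → 0 < η → 0 < θ R η) ∧
    ERung (fun R η => ((θ R η : ℝ) : WithBot ℝ))

/-! ## Dial monotonicity -/

/-- A budget pricing the larger set prices the smaller one: `Budget` is monotone in the threshold. -/
theorem budget_mono {θ θ' : ℝ → ℝ → WithBot ℝ} (h : ∀ R η : ℝ, 0 < R → 0 < η → θ R η ≤ θ' R η)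
    (P₀ : PeriodicConfiguration 3) : Budget θ P₀ → Budget θ' P₀ := by
  classical
  intro hB R η hR hη
  obtain ⟨c, hc, hcB⟩ := hB R η hR hη
  refine ⟨c, hc, fun N x hx => le_trans ?_ (hcB N x hx)⟩
  have hle : Nat.card {i : Fin N // ¬ LayeredGood R η x i ∧
        θ' R η ≤ ((siteEnergy lennardJones x i - 2 * P₀.energyPerParticle lennardJones : ℝ) :
          WithBot ℝ)} ≤
      Nat.card {i : Fin N // ¬ LayeredGood R η x i ∧
        θ R η ≤ ((siteEnergy lennardJones x i - 2 * P₀.energyPerParticle lennardJones : ℝ) :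
          WithBot ℝ)} := by
    rw [Nat.card_eq_fintype_card, Nat.card_eq_fintype_card]
    exact Fintype.card_subtype_mono _ _ fun i hi => ⟨hi.1, (h R η hR hη).trans hi.2⟩
  exact mul_le_mul_of_nonneg_left (by exact_mod_cast hle) hc.le

/-- `ERung` is ANTITONE for the budget order: raising the threshold strengthens the rung. -/
theorem eRung_anti {θ θ' : ℝ → ℝ → WithBot ℝ} (h : ∀ R η : ℝ, 0 < R → 0 < η → θ R η ≤ θ' R η) :
    ERung θ' → ERung θ :=
  fun H P₀ hF hB x hx => H P₀ hF (budget_mono h P₀ hB) x hx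

/-! ## F3 — the family at `θ = ⊥` is the proved floor -/

/-- **F3.** `ERung ⊥` — every bad site priced — is the seed `FloorGivesLayered_proof` followed by the
proved `PeriodicGivenLayered_holds`. [folklore] -/
theorem eRung_bot : ERung ⊥ := by
  intro P₀ hF hB x hx
  refine Theses.FluxTubeKepler.PeriodicGivenLayered_holds x hx
    (Theorems.FluxTubeKeplerFloorGivesLayered.FloorGivesLayered_proof P₀ hF ?_ x hx)
  intro R η hR hη
  obtain ⟨c, hc, hcB⟩ := hB R η hR hη
  refine ⟨c, hc, fun N y hy => ?_⟩
  show c * (Nat.card {i : Fin N // ¬ LayeredGood R η y i} : ℝ) ≤ _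
  simpa only [Pi.bot_apply, bot_le, and_true] using hcB N y hy

example : ERung ⊥ := eRung_bot

/-- Every member of the family gives the floor member back (the dial is antitone). -/
theorem eRung_bot_of_energyBlindRung (h : EnergyBlindRung) : ERung ⊥ := by
  obtain ⟨θ, -, H⟩ := h
  exact eRung_anti (fun R η _ _ => bot_le) H

end Summit.AtomisticToContinuum.Crystallization.Cruxes.FluxCellKepler.EnergyLadder.Special

end
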